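import Mathlib
import Literature.NumberTheory.LFunctions.Zhang2022.Section5Lemma53Phase
import HarnessLib

/-!
# Zhang (2022), §5, proof of Lemma 5.4: "By (5.10) we have
# `Δ″(x) = −4π² ∫ (e^u − 1)² exp{s₀u − 𝓛₂²u² − 2πix(e^u − 1)} du`" (differentiation under the
# integral sign, twice) and the pointwise step "`x^{s−1} = 1 + O(α log 𝓛)`", kernel-checked

Topic `Literature/NumberTheory/LFunctions/Zhang2022` (Landau–Siegel autopsy tree; verdict-neutral).
Y. Zhang, *Discrete mean estimates and the Landau–Siegel zero*, arXiv:2211.02515v1 (2022) — **an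
unrefereed manuscript, a claimed result under adjudication** (cell pub-zhang: audit + repair census
of arXiv:2211.02515; no claim about Landau–Siegel).

Glossary: `\l` = `𝓛 = log D` ((2.1)); `𝓛₁` (2.8); `𝓛₂ = 𝓛^{400}` ((2.15)); `α` (2.7); `s₀ = 1/2 + 2πit₀`;
here `𝓛₂`, `t₀`, `x` are free reals `L₂ ≠ 0`, `t₀`, `x`. Source text, §5 p. 11, proof of Lemma 5.4:

> Proof. (i). Using partial integration twice we obtain `δ(s) = (1/(s(s+1))) ∫₀^∞ Δ″(x)x^{s+1} ds`.
> By (5.10) we have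
> `Δ″(x) = −4π² ∫_{−∞}^{∞} (e^u − 1)² exp{s₀u − B²u² − 2πix(e^u − 1)} du.`
> Thus some upper bounds for `Δ″(x)` analogous to Lemma 5.3 can be obtained, and (i) follows.
> (ii). Assume `|s − 1| < 10α`. […] For `|x − t₀| < 𝓛₁` we have `x^{s−1} = 1 + O(α log 𝓛)`.
> Since `∫₀^∞ ω(1/2 + 2πix) dx = 1 + O(ε)`, (ii) follows.

(`B` in the display is evidently `𝓛₂`; the printed `ds` in the first display is `dx`.) PROVED here,
with `Δ` read through (5.10) (`Lemma53.Delta510`, `Lemma53.phase` of `Section5Lemma53Phase`):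

* `Lemma53.hasDerivAt_phaseInt` — for every `n`, `x ↦ ∫ (−2πi(e^u−1))ⁿ e^{phase(x,u)} du` is
  differentiable with derivative the `(n+1)`-st such integral (dominated differentiation under the
  integral; the dominating function `(2π(e^u+1))^{n+1} e^{u/2 − 𝓛₂²u²}` does not depend on `x`);
* `Lemma53.hasDerivAt_Delta510`, `Lemma53.deriv_Delta510`, **`Lemma53.deriv_deriv_Delta510`** — the
  display: `Δ″(x) = −4π² ∫ (e^u − 1)² exp{s₀u − 𝓛₂²u² − 2πix(e^u − 1)} du`, EXACT;
* `Lemma53.norm_cpow_sub_one_le` — the pointwise step of (ii): `‖x^z − 1‖ ≤ 2‖z‖|log x|` once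
  `‖z‖|log x| ≤ 1` (`z = s − 1`; with `|s−1| < 10α`, `x ≍ t₀` this is the printed `O(α log 𝓛)`-type
  bound — the manuscript's parameter values are not introduced);
  the last step "`∫₀^∞ ω = 1 + O(ε)`" is `SmoothWeight.one_sub_le_integral_omegaLine_Ioi` /
  `integral_omegaLine_Ioi_le_one` of `Section2SmoothWeight`.

NOT reproduced: the two partial integrations for `δ(s)` (they need the decay of `Δ, Δ′, Δ″` from
Lemma 5.3, whose contour assembly is not in the kernel), the "upper bounds for `Δ″` analogous to
Lemma 5.3", and the `O(ε)` tail of (ii). Nothing about Theorems 1–2 of the source is stated or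
implied; nothing here bears on the cell's verdict on (8.24).

## References

* Y. Zhang, arXiv:2211.02515v1 (2022), §5 p. 11, Lemma 5.4 and its proof; (5.10), (5.14).
  [cite: Zhang2022LandauSiegel, §5 Lemma 5.4 (proof)]
-/

noncomputable section

open Complex Real Set MeasureTheory Filter Topology

namespace Literature.NumberTheory.LFunctions.Zhang2022

namespace Lemma53

/-- The factor produced by one `x`-derivative of `exp{phase}`: `−2πi(e^u − 1)`.
[cite: Zhang2022LandauSiegel, §5 Lemma 5.4 (proof)] -/
def dfac (u : ℝ) : ℂ := -(2 * π * I * (cexp u - 1))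

/-- `∫ (−2πi(e^u − 1))ⁿ exp{s₀u − 𝓛₂²u² − 2πix(e^u − 1)} du` — the candidate for `Δ^{(n)}(x)`.
[cite: Zhang2022LandauSiegel, §5 Lemma 5.4 (proof)] -/
def phaseInt (n : ℕ) (L₂ t₀ x : ℝ) : ℂ := ∫ u : ℝ, dfac u ^ n * cexp (phase L₂ t₀ x u)

/-- Unfolding lemma for `dfac`. [cite: Zhang2022LandauSiegel, §5 Lemma 5.4 (proof)] -/
lemma dfac_def (u : ℝ) : dfac u = -(2 * π * I * (cexp u - 1)) := rfl

/-- Unfolding lemma for `phaseInt`. [cite: Zhang2022LandauSiegel, §5 Lemma 5.4 (proof)] -/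
lemma phaseInt_def (n : ℕ) (L₂ t₀ x : ℝ) :
    phaseInt n L₂ t₀ x = ∫ u : ℝ, dfac u ^ n * cexp (phase L₂ t₀ x u) := rfl

/-- `phaseInt 0 = Δ` of (5.10). [cite: Zhang2022LandauSiegel, §5 (5.10)] -/
lemma phaseInt_zero (L₂ t₀ x : ℝ) : phaseInt 0 L₂ t₀ x = Delta510 L₂ t₀ x := by
  simp [phaseInt_def, Delta510]

/-- `|−2πi(e^u − 1)| = 2π|e^u − 1| ≤ 2π(e^u + 1)`. [folklore] -/
lemma norm_dfac_le (u : ℝ) : ‖dfac u‖ ≤ 2 * π * (Real.exp u + 1) := by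
  rw [dfac_def, norm_neg]
  have h1 : ‖cexp (u : ℂ) - 1‖ ≤ Real.exp u + 1 := by
    calc ‖cexp (u : ℂ) - 1‖ ≤ ‖cexp (u : ℂ)‖ + ‖(1 : ℂ)‖ := norm_sub_le _ _
      _ = Real.exp u + 1 := by rw [Complex.norm_exp, ofReal_re, norm_one]
  calc ‖2 * π * I * (cexp (u : ℂ) - 1)‖ = 2 * π * ‖cexp (u : ℂ) - 1‖ := by
        simp [Complex.norm_real, Real.norm_eq_abs, abs_of_pos Real.pi_pos]
    _ ≤ 2 * π * (Real.exp u + 1) := by gcongr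

/-- `u ↦ e^{cu − 𝓛₂²u²}` is integrable (`𝓛₂ ≠ 0`). [folklore] -/
lemma integrable_exp_lin_sub_sq {L₂ : ℝ} (hL : L₂ ≠ 0) (c : ℝ) :
    Integrable fun u : ℝ => Real.exp (c * u - L₂ ^ 2 * u ^ 2) := by
  have hb : (-(L₂ : ℂ) ^ 2).re < 0 := by
    have : (-(L₂ : ℂ) ^ 2) = ((-(L₂ ^ 2) : ℝ) : ℂ) := by push_cast; ring
    rw [this, ofReal_re]
    have : 0 < L₂ ^ 2 := by positivity
    linarith
  have hg : Integrable fun u : ℝ => cexp (-(L₂ : ℂ) ^ 2 * (u : ℂ) ^ 2 + (c : ℂ) * u + 0) :=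
    integrable_cexp_quadratic' hb _ _
  refine (hg.norm).congr (Eventually.of_forall fun u => ?_)
  simp only
  rw [Complex.norm_exp]
  congr 1
  have : (-(L₂ : ℂ) ^ 2 * (u : ℂ) ^ 2 + (c : ℂ) * u + 0) = ((c * u - L₂ ^ 2 * u ^ 2 : ℝ) : ℂ) := by
    push_cast; ring
  rw [this, ofReal_re]

/-- `(e^u + 1)ⁿ ≤ 2ⁿ(e^{nu} + 1)`. [folklore] -/
lemma exp_add_one_pow_le (u : ℝ) (n : ℕ) :
    (Real.exp u + 1) ^ n ≤ 2 ^ n * (Real.exp (n * u) + 1) := by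
  rw [Real.exp_nat_mul]
  rcases le_or_gt 0 u with hu | hu
  · have h1 : 1 ≤ Real.exp u := Real.one_le_exp hu
    calc (Real.exp u + 1) ^ n ≤ (2 * Real.exp u) ^ n :=
          pow_le_pow_left₀ (by positivity) (by linarith) n
      _ = 2 ^ n * Real.exp u ^ n := by rw [mul_pow]
      _ ≤ 2 ^ n * (Real.exp u ^ n + 1) := by gcongr; linarith
  · have h1 : Real.exp u ≤ 1 := by rw [Real.exp_le_one_iff]; exact hu.le
    calc (Real.exp u + 1) ^ n ≤ 2 ^ n := pow_le_pow_left₀ (by positivity) (by linarith) n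
      _ ≤ 2 ^ n * (Real.exp u ^ n + 1) := by
          have : 0 ≤ Real.exp u ^ n := by positivity
          nlinarith [pow_pos (show (0:ℝ) < 2 by norm_num) n]

/-- The dominating function: `(2π(e^u+1))ⁿ e^{u/2 − 𝓛₂²u²}` is integrable. [folklore] -/
lemma integrable_bound {L₂ : ℝ} (hL : L₂ ≠ 0) (n : ℕ) :
    Integrable fun u : ℝ => (2 * π * (Real.exp u + 1)) ^ n * Real.exp (u / 2 - L₂ ^ 2 * u ^ 2) := by
  have h1 := integrable_exp_lin_sub_sq hL ((n : ℝ) + 1 / 2)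
  have h2 := integrable_exp_lin_sub_sq hL (1 / 2)
  have hsum : Integrable fun u : ℝ =>
      (2 * π) ^ n * 2 ^ n * (Real.exp (((n : ℝ) + 1 / 2) * u - L₂ ^ 2 * u ^ 2)
        + Real.exp (1 / 2 * u - L₂ ^ 2 * u ^ 2)) := (h1.add h2).const_mul _
  refine hsum.mono' (by fun_prop) (Eventually.of_forall fun u => ?_)
  have hpos : 0 ≤ (2 * π * (Real.exp u + 1)) ^ n * Real.exp (u / 2 - L₂ ^ 2 * u ^ 2) := by
    positivity
  rw [Real.norm_of_nonneg hpos, mul_pow]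
  have h3 := exp_add_one_pow_le u n
  have h4 : Real.exp (((n : ℝ) + 1 / 2) * u - L₂ ^ 2 * u ^ 2)
      = Real.exp (n * u) * Real.exp (u / 2 - L₂ ^ 2 * u ^ 2) := by
    rw [← Real.exp_add]; congr 1; ring
  have h5 : Real.exp (1 / 2 * u - L₂ ^ 2 * u ^ 2) = Real.exp (u / 2 - L₂ ^ 2 * u ^ 2) := by
    congr 1; ring
  rw [h4, h5]
  have hE : 0 ≤ Real.exp (u / 2 - L₂ ^ 2 * u ^ 2) := (Real.exp_pos _).le
  calc (2 * π) ^ n * (Real.exp u + 1) ^ n * Real.exp (u / 2 - L₂ ^ 2 * u ^ 2)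
      ≤ (2 * π) ^ n * (2 ^ n * (Real.exp (n * u) + 1)) * Real.exp (u / 2 - L₂ ^ 2 * u ^ 2) := by
        gcongr
    _ = (2 * π) ^ n * 2 ^ n * (Real.exp (n * u) * Real.exp (u / 2 - L₂ ^ 2 * u ^ 2)
          + Real.exp (u / 2 - L₂ ^ 2 * u ^ 2)) := by ring

/-- Pointwise bound: `‖(−2πi(e^u−1))ⁿ e^{phase(x,u)}‖ ≤ (2π(e^u+1))ⁿ e^{u/2 − 𝓛₂²u²}`, uniformly
in `x`. [folklore] -/
lemma norm_dfac_pow_mul_cexp_phase_le (L₂ t₀ x u : ℝ) (n : ℕ) :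
    ‖dfac u ^ n * cexp (phase L₂ t₀ x u)‖
      ≤ (2 * π * (Real.exp u + 1)) ^ n * Real.exp (u / 2 - L₂ ^ 2 * u ^ 2) := by
  rw [norm_mul, norm_pow, norm_cexp_phase_ofReal]
  gcongr
  exact norm_dfac_le u

/-- The integrand is continuous in `u`. [folklore] -/
lemma continuous_dfac_pow_mul_cexp_phase (L₂ t₀ x : ℝ) (n : ℕ) :
    Continuous fun u : ℝ => dfac u ^ n * cexp (phase L₂ t₀ x u) := by
  unfold dfac phase
  fun_prop

/-- The integrand `(−2πi(e^u−1))ⁿ e^{phase(x,u)}` is integrable in `u` (`𝓛₂ ≠ 0`). [folklore] -/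
theorem integrable_dfac_pow_mul_cexp_phase {L₂ : ℝ} (hL : L₂ ≠ 0) (n : ℕ) (t₀ x : ℝ) :
    Integrable fun u : ℝ => dfac u ^ n * cexp (phase L₂ t₀ x u) :=
  (integrable_bound hL n).mono' (continuous_dfac_pow_mul_cexp_phase L₂ t₀ x n).aestronglyMeasurable
    (Eventually.of_forall fun u => norm_dfac_pow_mul_cexp_phase_le L₂ t₀ x u n)

/-- `∂/∂x exp{phase(x,u)} = −2πi(e^u − 1)·exp{phase(x,u)}` (the phase is affine in `x`). [folklore] -/
lemma hasDerivAt_cexp_phase (L₂ t₀ x u : ℝ) (n : ℕ) :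
    HasDerivAt (fun y : ℝ => dfac u ^ n * cexp (phase L₂ t₀ y u))
      (dfac u ^ (n + 1) * cexp (phase L₂ t₀ x u)) x := by
  have hx : HasDerivAt (fun y : ℝ => (y : ℂ)) 1 x := by
    simpa using (hasDerivAt_id x).ofReal_comp
  have hph : HasDerivAt (fun y : ℝ => phase L₂ t₀ y u) (dfac u) x := by
    have h := ((hx.const_mul (2 * π * I)).mul_const (cexp (u : ℂ) - 1)).const_sub
      ((1 / 2 + 2 * π * t₀ * I) * (u : ℂ) - (L₂ : ℂ) ^ 2 * (u : ℂ) ^ 2)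
    have e1 : (fun y : ℝ => (1 / 2 + 2 * π * t₀ * I) * (u : ℂ) - (L₂ : ℂ) ^ 2 * (u : ℂ) ^ 2
        - 2 * π * I * (y : ℂ) * (cexp (u : ℂ) - 1)) = fun y : ℝ => phase L₂ t₀ y u := by
      funext y; rw [phase_def]
    have e2 : -(2 * π * I * 1 * (cexp (u : ℂ) - 1)) = dfac u := by rw [dfac_def]; ring
    rw [e1, e2] at h
    exact h
  have h2 := (hph.cexp).const_mul (dfac u ^ n)
  have e3 : dfac u ^ n * (cexp (phase L₂ t₀ x u) * dfac u)
      = dfac u ^ (n + 1) * cexp (phase L₂ t₀ x u) := by ring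
  rw [e3] at h2
  exact h2

/-- **Differentiation under the integral sign**: for every `n`,
`d/dx ∫ (−2πi(e^u−1))ⁿ e^{phase(x,u)} du = ∫ (−2πi(e^u−1))^{n+1} e^{phase(x,u)} du`.
[cite: Zhang2022LandauSiegel, §5 Lemma 5.4 (proof, "By (5.10) we have …")] -/
theorem hasDerivAt_phaseInt {L₂ : ℝ} (hL : L₂ ≠ 0) (n : ℕ) (t₀ x : ℝ) :
    HasDerivAt (fun y : ℝ => phaseInt n L₂ t₀ y) (phaseInt (n + 1) L₂ t₀ x) x := by
  simp only [phaseInt_def]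
  have h := hasDerivAt_integral_of_dominated_loc_of_deriv_le (μ := volume)
    (F := fun (y : ℝ) (u : ℝ) => dfac u ^ n * cexp (phase L₂ t₀ y u))
    (F' := fun (y : ℝ) (u : ℝ) => dfac u ^ (n + 1) * cexp (phase L₂ t₀ y u))
    (x₀ := x) (s := univ)
    (bound := fun u : ℝ => (2 * π * (Real.exp u + 1)) ^ (n + 1) * Real.exp (u / 2 - L₂ ^ 2 * u ^ 2))
    univ_mem
    (Eventually.of_forall fun y =>
      (continuous_dfac_pow_mul_cexp_phase L₂ t₀ y n).aestronglyMeasurable)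
    (integrable_dfac_pow_mul_cexp_phase hL n t₀ x)
    (continuous_dfac_pow_mul_cexp_phase L₂ t₀ x (n + 1)).aestronglyMeasurable
    (Eventually.of_forall fun u y _ => norm_dfac_pow_mul_cexp_phase_le L₂ t₀ y u (n + 1))
    (integrable_bound hL (n + 1))
    (Eventually.of_forall fun u y _ => hasDerivAt_cexp_phase L₂ t₀ y u n)
  exact h.2

/-- `Δ′(x) = ∫ (−2πi(e^u−1)) e^{phase(x,u)} du`. [cite: Zhang2022LandauSiegel, §5 Lemma 5.4 (proof)] -/
theorem hasDerivAt_Delta510 {L₂ : ℝ} (hL : L₂ ≠ 0) (t₀ x : ℝ) :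
    HasDerivAt (Delta510 L₂ t₀) (phaseInt 1 L₂ t₀ x) x := by
  have h := hasDerivAt_phaseInt hL 0 t₀ x
  have e : (fun y : ℝ => phaseInt 0 L₂ t₀ y) = Delta510 L₂ t₀ := by
    funext y; exact phaseInt_zero L₂ t₀ y
  rwa [e] at h

/-- `Δ′ = phaseInt 1`. [cite: Zhang2022LandauSiegel, §5 Lemma 5.4 (proof)] -/
theorem deriv_Delta510 {L₂ : ℝ} (hL : L₂ ≠ 0) (t₀ : ℝ) :
    deriv (Delta510 L₂ t₀) = fun x => phaseInt 1 L₂ t₀ x := by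
  funext x
  exact (hasDerivAt_Delta510 hL t₀ x).deriv

/-- **"By (5.10) we have `Δ″(x) = −4π² ∫ (e^u − 1)² exp{s₀u − 𝓛₂²u² − 2πix(e^u − 1)} du`"**, EXACT
(`Δ` read through (5.10)). [cite: Zhang2022LandauSiegel, §5 Lemma 5.4 (proof)] -/
theorem deriv_deriv_Delta510 {L₂ : ℝ} (hL : L₂ ≠ 0) (t₀ x : ℝ) :
    deriv (deriv (Delta510 L₂ t₀)) x
      = -(4 * π ^ 2) * ∫ u : ℝ, (cexp u - 1) ^ 2 * cexp (phase L₂ t₀ x u) := by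
  rw [deriv_Delta510 hL t₀, (hasDerivAt_phaseInt hL 1 t₀ x).deriv, phaseInt_def,
    ← integral_const_mul]
  congr 1
  funext u
  rw [dfac_def]
  ring_nf
  rw [I_sq]
  ring

/-! ## Lemma 5.4 (ii): the pointwise step `x^{s−1} = 1 + O(α log 𝓛)` -/

/-- For real `x > 0` and complex `z` with `‖z‖·|log x| ≤ 1`: `‖x^z − 1‖ ≤ 2‖z‖·|log x|`
(the source, with `z = s − 1`, `|s − 1| < 10α`, `|x − t₀| < 𝓛₁`: "`x^{s−1} = 1 + O(α log 𝓛)`").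
[cite: Zhang2022LandauSiegel, §5 Lemma 5.4 (ii) (proof)] -/
theorem norm_cpow_sub_one_le {x : ℝ} (hx : 0 < x) {z : ℂ} (h : ‖z‖ * |Real.log x| ≤ 1) :
    ‖(x : ℂ) ^ z - 1‖ ≤ 2 * (‖z‖ * |Real.log x|) := by
  have hx0 : (x : ℂ) ≠ 0 := ofReal_ne_zero.mpr hx.ne'
  rw [Complex.cpow_def_of_ne_zero hx0, ← Complex.ofReal_log hx.le]
  have hn : ‖(Real.log x : ℂ) * z‖ = ‖z‖ * |Real.log x| := by
    rw [norm_mul, Complex.norm_real, Real.norm_eq_abs, mul_comm]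
  have := Complex.norm_exp_sub_one_le (x := (Real.log x : ℂ) * z) (by rw [hn]; exact h)
  rwa [hn] at this

end Lemma53

end Literature.NumberTheory.LFunctions.Zhang2022
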